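import Summits.AtomisticToContinuum.HydrodynamicLimit.Theorems.RelayRaceLocalityConeLocalisationBubbleHypDefs
import Summits.AtomisticToContinuum.HydrodynamicLimit.Theorems.RelayRaceLocalityConeLocalisationBubbleZoom
import Summits.AtomisticToContinuum.HydrodynamicLimit.Theorems.RelayRaceLocalityConeLocalisationBubbleZoomB
import HarnessLib

/-!
# RelayRaceLocality · ConeLocalisation — bubble stub: the zoom input `ZoomHyp` discharged

Lead-held stub `stub_bubble : BubbleAtScale` of line `Sketch`, crux `stmt-AtomisticToContinuum-12504`; lead
prover-line-stmt-AtomisticToContinuum-12504-0 (2026-08-17). The typed input `Bubble.ZoomHyp` of the bubble assembly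
(`…BubbleHypDefs.lean`) is exactly the content of the landed zoom files (`…BubbleZoom.lean` p134720,
`…BubbleZoomB.lean` p135066, worker w-zoom): the zoom map `zoomPt x₀ m`, its distance identity
(`euclidDist_zoomPt`), the inverse-point formula (`zoomPt_unzoom`), the function-level dictionary (`isSmooth_zoom`,
`partialDeriv_zoom(_mul)`, `zoom_eq_of_le`) and the covariance of `IsHardSphereEulerSolution` under
`(s, y) ↦ (s/m, zoomPt x₀ m y)` (`isHardSphereEulerSolution_zoom`, which needs no packing hypothesis — the packing
slot of `ZoomHyp` is not used).
-/

noncomputable section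

namespace Summit.AtomisticToContinuum.HydrodynamicLimit.Theorems.ConeLocalisation.Bubble

open Set
open Literature.MathematicalPhysics.KineticTheory Literature.Analysis.FluidPDE
  Literature.Analysis.FunctionSpaces

/-- **The zoom input of the bubble assembly holds** (hyperbolic zoom covariance of compactly supported bubbles on
`𝕋³`, assembled from the landed zoom files). [folklore] -/
theorem zoomHyp_holds : ZoomHyp := by
  refine ⟨1, one_pos, fun x₀ m a hm _ha hma => ⟨zoomPt x₀ m, ?_, ?_, ?_, ?_, ?_⟩⟩
  · exact fun y => euclidDist_zoomPt hm x₀ y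
  · intro x hx
    exact ⟨x₀ + Torus.proj (m • Torus.reprc (x - x₀)), zoomPt_unzoom (zero_lt_one.trans hm) hx⟩
  · intro f b hf hsupp
    exact ⟨isSmooth_zoom hf hm hma.le hsupp, fun y i => partialDeriv_zoom_mul hm hma hsupp i y,
      fun y hy => zoom_eq_of_le hm hsupp hy⟩
  · intro w b hw hsupp
    exact ⟨isSmooth_zoom hw hm hma.le hsupp, fun y i => partialDeriv_zoom hm hma hsupp i y,
      fun y hy => zoom_eq_of_le hm hsupp hy⟩
  · intro σ T ρ θ u hE ρbar θbar ubar hsupp _hpack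
    exact isHardSphereEulerSolution_zoom hE hm hma hsupp

end Summit.AtomisticToContinuum.HydrodynamicLimit.Theorems.ConeLocalisation.Bubble

end
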